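import Summits.QuantumAdvantage.QuantumAdvantage.Theorems.AnchorDialCount
import Literature.Computability.MetaComplexity.LowDegreeComposition

/-!
# AnchorDial — Datum (cell decomp-qadv, seat lens-2, generation 14 rev 3; supports item 26531 `ExactnessDial.PolyLossOddU3`)

§9 of the node, engine input (E1) BUILT: the polynomial DATUM of the counting shell.  `comp_flip2_mem` / `comp_orb_mem`
(pair-flips keep the degree, via `Smolensky.comp_mem_lowDeg_of_coord`), the selector / gap / wrap data `dSel` / `dGap` / `dWrap`
with their degrees, the datum map `datum` with its readers `sOfD` / `gOfD` / `wOfD`, **`datum_faithful`** (= hypothesis `hdat` of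
`count_shell`), the `𝔽₃` equality indicator `indEq`, the CLASS INDICATOR `classInd` with **`classInd_mem`** (degree `148·D`) and
**`classInd_apply` / `classInd_eq_one_iff`** (it is the `0/1` indicator of the datum class).

Split (≤ 400 lines, part 6/7) of the node file `HOME/decomp-qadv-lens-2/g14/AnchorDial.lean` (rev 3; sha256 in SHA256SUMS.txt, farm rc 0, no
placeholders); declarations verbatim, namespace `Summit.QuantumAdvantage.QuantumAdvantage.Theorems.AnchorDial`.  Record: NODE-g14.md.
-/

set_option linter.dupNamespace false
set_option linter.unusedVariables false

noncomputable section

open scoped Classical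

namespace Summit.QuantumAdvantage.QuantumAdvantage.Theorems.AnchorDial

open Finset
open Literature.Computability.QuantumComplexity Literature.Computability.QuantumComplexity.RingHLF
open Literature.Computability.MetaComplexity Literature.Computability.MetaComplexity.Smolensky
open Summit.QuantumAdvantage.AdviceFreeQNC0
open Summit.QuantumAdvantage.QuantumAdvantage.Theses (ExactnessDial.PolyLossOddU3 ExactnessDial.DPLift3)
-- only the tree gadgets we use (the g13 package keeps landing under `Theorems.HolonomyDial`; no blanket `open`)
open Summit.QuantumAdvantage.QuantumAdvantage.Theorems.HolonomyDial (gCond selP selP_mem selP_apply)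

variable {N : ℕ}

/-! ## §9 (E1) The polynomial DATUM: selector / gap / wrap read by polylog-degree polynomials, the class
indicator and its degree -/

section Datum

/-- composing with a pair-flip keeps the degree (each coordinate of `flip2` is `x_j` or `1 - x_j`). -/
theorem comp_flip2_mem {D : ℕ} {P : CubeFn (ZMod 3) N} (hP : P ∈ lowDeg (ZMod 3) N D) (a b : ℕ) :
    (fun x => P (flip2 a b x)) ∈ lowDeg (ZMod 3) N D := by
  refine Smolensky.comp_mem_lowDeg_of_coord (F := ZMod 3) (flip2 a b) (fun i => ?_) hP
  by_cases hi : i.val = a ∨ i.val = b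
  · have h : (fun u : Fin N → Bool => if flip2 a b u i = true then (1 : ZMod 3) else 0) =
        1 - mono (ZMod 3) {i} := by
      funext u
      simp only [flip2, if_pos hi, Pi.sub_apply, Pi.one_apply, mono_apply, mem_singleton, forall_eq]
      cases u i <;> simp
    rw [h]
    exact Submodule.sub_mem _ (one_mem_lowDeg 1) (mono_mem_lowDeg (by simp))
  · have h : (fun u : Fin N → Bool => if flip2 a b u i = true then (1 : ZMod 3) else 0) = mono (ZMod 3) {i} := by
      funext u
      simp only [flip2, if_neg hi, mono_apply, mem_singleton, forall_eq]
    rw [h]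
    exact mono_mem_lowDeg (by simp)

/-- AnchorDialDatum helper `comp_fz_mem` (decomp-qadv land package; see the module docstring). -/
theorem comp_fz_mem {D : ℕ} {P : CubeFn (ZMod 3) N} (hP : P ∈ lowDeg (ZMod 3) N D) (e : Bool) (a : ℕ) :
    (fun x => P (fz e a x)) ∈ lowDeg (ZMod 3) N D := by
  cases e
  · exact hP
  · exact comp_flip2_mem hP a (a + 1)

/-- AnchorDialDatum helper `comp_orb_mem` (decomp-qadv land package; see the module docstring). -/
theorem comp_orb_mem {D : ℕ} {P : CubeFn (ZMod 3) N} (hP : P ∈ lowDeg (ZMod 3) N D) (b₁ b₂ b₃ b₄ : ℕ)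
    (ε : Core.B4) : (fun x => P (orb b₁ b₂ b₃ b₄ ε x)) ∈ lowDeg (ZMod 3) N D :=
  comp_fz_mem (comp_fz_mem (comp_fz_mem (comp_fz_mem hP ε.1 b₁) ε.2.1 b₂) ε.2.2.1 b₃) ε.2.2.2 b₄

/-- selector datum `Σ_k selP(A_k)(x) · selP(f_k)(x^ε)` (= `[f_k(x^ε) = 1]` at the unique anchor `k`). -/
def dSel (A f : Fin N → CubeFn (ZMod 3) N) (b₁ b₂ b₃ b₄ : ℕ) (ε : Core.B4) : CubeFn (ZMod 3) N :=
  ∑ k : Fin N, selP (A k) * fun x => selP (f k) (orb b₁ b₂ b₃ b₄ ε x)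

/-- gap datum `Σ_{k ≥ b+1} selP(A_k)` (= `[b + 1 ≤ anchor]`). -/
def dGap (A : Fin N → CubeFn (ZMod 3) N) (b : ℕ) : CubeFn (ZMod 3) N :=
  ∑ k ∈ univ.filter (fun k : Fin N => b + 1 ≤ k.val), selP (A k)

/-- wrap datum (= `[anchor = n - 1]`). -/
def dWrap (A : Fin N → CubeFn (ZMod 3) N) : CubeFn (ZMod 3) N :=
  ∑ k ∈ univ.filter (fun k : Fin N => k.val = N - 1), selP (A k)

/-- AnchorDialDatum helper `dSel_mem` (decomp-qadv land package; see the module docstring). -/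
theorem dSel_mem {D : ℕ} {A f : Fin N → CubeFn (ZMod 3) N} (hA : ∀ k, A k ∈ lowDeg (ZMod 3) N D)
    (hf : ∀ k, f k ∈ lowDeg (ZMod 3) N D) (b₁ b₂ b₃ b₄ : ℕ) (ε : Core.B4) :
    dSel A f b₁ b₂ b₃ b₄ ε ∈ lowDeg (ZMod 3) N ((D + D) + (D + D)) := by
  unfold dSel
  exact Submodule.sum_mem _ fun k _ =>
    mul_mem_lowDeg_add (selP_mem (hA k)) (comp_orb_mem (selP_mem (hf k)) b₁ b₂ b₃ b₄ ε)

/-- AnchorDialDatum helper `dGap_mem` (decomp-qadv land package; see the module docstring). -/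
theorem dGap_mem {D : ℕ} {A : Fin N → CubeFn (ZMod 3) N} (hA : ∀ k, A k ∈ lowDeg (ZMod 3) N D) (b : ℕ) :
    dGap A b ∈ lowDeg (ZMod 3) N (D + D) := by
  unfold dGap
  exact Submodule.sum_mem _ fun k _ => selP_mem (hA k)

/-- AnchorDialDatum helper `dWrap_mem` (decomp-qadv land package; see the module docstring). -/
theorem dWrap_mem {D : ℕ} {A : Fin N → CubeFn (ZMod 3) N} (hA : ∀ k, A k ∈ lowDeg (ZMod 3) N D) :
    dWrap A ∈ lowDeg (ZMod 3) N (D + D) := by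
  unfold dWrap
  exact Submodule.sum_mem _ fun k _ => selP_mem (hA k)

/-- the datum type and map. -/
abbrev DatT : Type := (Core.B4 → ZMod 3) × (ZMod 3 × ZMod 3 × ZMod 3 × ZMod 3) × ZMod 3

/-- AnchorDialDatum helper `datum` (decomp-qadv land package; see the module docstring). -/
def datum (A f : Fin N → CubeFn (ZMod 3) N) (b₁ b₂ b₃ b₄ : ℕ) (x : Fin N → Bool) : DatT :=
  (fun ε => dSel A f b₁ b₂ b₃ b₄ ε x, (dGap A b₁ x, dGap A b₂ x, dGap A b₃ x, dGap A b₄ x), dWrap A x)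

/-- AnchorDialDatum helper `sOfD` (decomp-qadv land package; see the module docstring). -/
def sOfD (δ : DatT) : Core.B4 → Bool := fun ε => !decide (δ.1 ε = 1)

/-- AnchorDialDatum helper `gOfD` (decomp-qadv land package; see the module docstring). -/
def gOfD (δ : DatT) : Core.B4 :=
  (decide (δ.2.1.1 = 1), decide (δ.2.1.2.1 = 1), decide (δ.2.1.2.2.1 = 1), decide (δ.2.1.2.2.2 = 1))

/-- AnchorDialDatum helper `wOfD` (decomp-qadv land package; see the module docstring). -/
def wOfD (δ : DatT) : Bool := decide (δ.2.2 = 1)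

/-- AnchorDialDatum helper `selP_anchor` (decomp-qadv land package; see the module docstring). -/
theorem selP_anchor {A : Fin N → CubeFn (ZMod 3) N} {x : Fin N → Bool} {k₀ : Fin N} (hk : anc A x = {k₀})
    (k : Fin N) : selP (A k) x = if k = k₀ then 1 else 0 := by
  rw [selP_apply]
  have h : A k x = 1 ↔ k = k₀ := by
    have h1 := Finset.ext_iff.1 hk k
    simp only [anc, mem_filter, mem_univ, true_and, mem_singleton] at h1
    exact h1
  by_cases hk0 : k = k₀
  · rw [if_pos hk0, if_pos (h.2 hk0)]
  · rw [if_neg hk0, if_neg (fun h1 => hk0 (h.1 h1))]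

/-- AnchorDialDatum helper `decide_ite01` (decomp-qadv land package; see the module docstring). -/
theorem decide_ite01 (p : Prop) [Decidable p] : decide ((if p then (1 : ZMod 3) else 0) = 1) = decide p := by
  by_cases hp : p <;> simp [hp]

/-- **faithfulness**: on a uniquely anchored input the datum reads the selector bits along the orbit, the gap vector
and the wrap flag (hypothesis `hdat` of `count_shell`). -/
theorem datum_faithful (A f : Fin N → CubeFn (ZMod 3) N) (b₁ b₂ b₃ b₄ : ℕ) (x : Fin N → Bool) (k₀ : Fin N)
    (hk : anc A x = {k₀}) :
    sOfD (datum A f b₁ b₂ b₃ b₄ x) = (fun ε => !decide (f k₀ (orb b₁ b₂ b₃ b₄ ε x) = 1)) ∧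
      gOfD (datum A f b₁ b₂ b₃ b₄ x) = gvec b₁ b₂ b₃ b₄ k₀.val ∧
      wOfD (datum A f b₁ b₂ b₃ b₄ x) = decide (k₀.val = N - 1) := by
  have hsel : ∀ ε, dSel A f b₁ b₂ b₃ b₄ ε x = if f k₀ (orb b₁ b₂ b₃ b₄ ε x) = 1 then 1 else 0 := by
    intro ε
    unfold dSel
    rw [Finset.sum_apply, Finset.sum_eq_single k₀]
    · rw [Pi.mul_apply, selP_anchor hk, if_pos rfl, one_mul, selP_apply]
    · intro k _ hk0
      rw [Pi.mul_apply, selP_anchor hk, if_neg hk0, zero_mul]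
    · intro h; exact absurd (mem_univ _) h
  have hgap : ∀ b : ℕ, dGap A b x = if b + 1 ≤ k₀.val then 1 else 0 := by
    intro b
    unfold dGap
    rw [Finset.sum_apply]
    simp_rw [selP_anchor hk]
    rw [Finset.sum_ite_eq' (univ.filter fun k : Fin N => b + 1 ≤ k.val) k₀ (fun _ => (1 : ZMod 3))]
    simp only [mem_filter, mem_univ, true_and]
  have hwrap : dWrap A x = if k₀.val = N - 1 then 1 else 0 := by
    unfold dWrap
    rw [Finset.sum_apply]
    simp_rw [selP_anchor hk]
    rw [Finset.sum_ite_eq' (univ.filter fun k : Fin N => k.val = N - 1) k₀ (fun _ => (1 : ZMod 3))]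
    simp only [mem_filter, mem_univ, true_and]
  refine ⟨?_, ?_, ?_⟩
  · funext ε
    show (!decide (dSel A f b₁ b₂ b₃ b₄ ε x = 1)) = !decide (f k₀ (orb b₁ b₂ b₃ b₄ ε x) = 1)
    rw [hsel ε, decide_ite01]
  · show (decide (dGap A b₁ x = 1), decide (dGap A b₂ x = 1), decide (dGap A b₃ x = 1), decide (dGap A b₄ x = 1))
      = gvec b₁ b₂ b₃ b₄ k₀.val
    rw [hgap, hgap, hgap, hgap, decide_ite01, decide_ite01, decide_ite01, decide_ite01]
    rfl
  · show decide (dWrap A x = 1) = decide (k₀.val = N - 1)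
    rw [hwrap, decide_ite01]

/-- the `𝔽₃`-indicator of `P(x) = c`. -/
def indEq (P : CubeFn (ZMod 3) N) (c : ZMod 3) : CubeFn (ZMod 3) N := 1 - (P - c • 1) * (P - c • 1)

/-- AnchorDialDatum helper `indEq_apply` (decomp-qadv land package; see the module docstring). -/
theorem indEq_apply (P : CubeFn (ZMod 3) N) (c : ZMod 3) (x : Fin N → Bool) :
    indEq P c x = if P x = c then 1 else 0 := by
  simp only [indEq, Pi.sub_apply, Pi.mul_apply, Pi.one_apply, Pi.smul_apply, smul_eq_mul, mul_one]
  generalize P x = v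
  revert v c; decide

/-- AnchorDialDatum helper `indEq_mem` (decomp-qadv land package; see the module docstring). -/
theorem indEq_mem {D : ℕ} {P : CubeFn (ZMod 3) N} (hP : P ∈ lowDeg (ZMod 3) N D) (c : ZMod 3) :
    indEq P c ∈ lowDeg (ZMod 3) N (D + D) := by
  unfold indEq
  have h1 : P - c • 1 ∈ lowDeg (ZMod 3) N D := Submodule.sub_mem _ hP (Submodule.smul_mem _ c (one_mem_lowDeg D))
  exact Submodule.sub_mem _ (one_mem_lowDeg _) (mul_mem_lowDeg_add h1 h1)

/-- the CLASS INDICATOR of the datum value `δ`. -/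
def classInd (A f : Fin N → CubeFn (ZMod 3) N) (b₁ b₂ b₃ b₄ : ℕ) (δ : DatT) : CubeFn (ZMod 3) N :=
  (∏ ε : Core.B4, indEq (dSel A f b₁ b₂ b₃ b₄ ε) (δ.1 ε)) *
    (indEq (dGap A b₁) δ.2.1.1 * indEq (dGap A b₂) δ.2.1.2.1 * indEq (dGap A b₃) δ.2.1.2.2.1 *
      indEq (dGap A b₄) δ.2.1.2.2.2 * indEq (dWrap A) δ.2.2)

/-- degree of the class indicator: `148·D` for a degree-`D` certificate. -/
theorem classInd_mem {D : ℕ} {A f : Fin N → CubeFn (ZMod 3) N} (hA : ∀ k, A k ∈ lowDeg (ZMod 3) N D)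
    (hf : ∀ k, f k ∈ lowDeg (ZMod 3) N D) (b₁ b₂ b₃ b₄ : ℕ) (δ : DatT) :
    classInd A f b₁ b₂ b₃ b₄ δ ∈ lowDeg (ZMod 3) N (148 * D) := by
  unfold classInd
  have hs : ∀ ε, indEq (dSel A f b₁ b₂ b₃ b₄ ε) (δ.1 ε) ∈ lowDeg (ZMod 3) N (8 * D) := fun ε => by
    have h := indEq_mem (dSel_mem hA hf b₁ b₂ b₃ b₄ ε) (δ.1 ε)
    exact lowDeg_mono (by omega) h
  have hprod : (∏ ε : Core.B4, indEq (dSel A f b₁ b₂ b₃ b₄ ε) (δ.1 ε)) ∈ lowDeg (ZMod 3) N (128 * D) := by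
    have h := prod_mem_lowDeg (univ : Finset Core.B4) (D := 8 * D) (fun ε _ => hs ε)
    rw [card_univ, card_B4] at h
    exact lowDeg_mono (by omega) h
  have hg : ∀ b c, indEq (dGap A b) c ∈ lowDeg (ZMod 3) N (4 * D) := fun b c =>
    lowDeg_mono (by omega) (indEq_mem (dGap_mem hA b) c)
  have hw : ∀ c, indEq (dWrap A) c ∈ lowDeg (ZMod 3) N (4 * D) := fun c =>
    lowDeg_mono (by omega) (indEq_mem (dWrap_mem hA) c)
  have hrest : indEq (dGap A b₁) δ.2.1.1 * indEq (dGap A b₂) δ.2.1.2.1 * indEq (dGap A b₃) δ.2.1.2.2.1 *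
      indEq (dGap A b₄) δ.2.1.2.2.2 * indEq (dWrap A) δ.2.2 ∈ lowDeg (ZMod 3) N (20 * D) := by
    have h := mul_mem_lowDeg_add (mul_mem_lowDeg_add (mul_mem_lowDeg_add (mul_mem_lowDeg_add
      (hg b₁ δ.2.1.1) (hg b₂ δ.2.1.2.1)) (hg b₃ δ.2.1.2.2.1)) (hg b₄ δ.2.1.2.2.2)) (hw δ.2.2)
    exact lowDeg_mono (by omega) h
  exact lowDeg_mono (by omega) (mul_mem_lowDeg_add hprod hrest)

/-- the class indicator is the `0/1` indicator of the datum class. -/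
theorem classInd_apply (A f : Fin N → CubeFn (ZMod 3) N) (b₁ b₂ b₃ b₄ : ℕ) (δ : DatT) (x : Fin N → Bool) :
    classInd A f b₁ b₂ b₃ b₄ δ x = if datum A f b₁ b₂ b₃ b₄ x = δ then 1 else 0 := by
  obtain ⟨δs, ⟨g₁, g₂, g₃, g₄⟩, w⟩ := δ
  simp only [classInd, Pi.mul_apply, Finset.prod_apply, indEq_apply]
  rw [Finset.prod_boole]
  simp only [mem_univ, true_implies]
  by_cases h : datum A f b₁ b₂ b₃ b₄ x = (δs, (g₁, g₂, g₃, g₄), w)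
  · rw [if_pos h]
    simp only [datum, Prod.mk.injEq] at h
    obtain ⟨hs, ⟨h1, h2, h3, h4⟩, hw⟩ := h
    rw [if_pos (fun ε => congrFun hs ε), if_pos h1, if_pos h2, if_pos h3, if_pos h4, if_pos hw]
    norm_num
  · rw [if_neg h]
    simp only [datum, Prod.mk.injEq, not_and_or] at h
    rcases h with h | h | h
    · rw [if_neg (fun hall => h (funext hall))]; simp
    · rcases h with h | h | h | h
      · rw [if_neg h]; simp
      · rw [if_neg h]; simp
      · rw [if_neg h]; simp
      · rw [if_neg h]; simp
    · rw [if_neg h]; simp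

/-- AnchorDialDatum helper `classInd_eq_one_iff` (decomp-qadv land package; see the module docstring). -/
theorem classInd_eq_one_iff (A f : Fin N → CubeFn (ZMod 3) N) (b₁ b₂ b₃ b₄ : ℕ) (δ : DatT) (x : Fin N → Bool) :
    classInd A f b₁ b₂ b₃ b₄ δ x = 1 ↔ datum A f b₁ b₂ b₃ b₄ x = δ := by
  rw [classInd_apply]
  by_cases h : datum A f b₁ b₂ b₃ b₄ x = δ
  · simp [h]
  · rw [if_neg h]; simp [h]

end Datum

end Summit.QuantumAdvantage.QuantumAdvantage.Theorems.AnchorDial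

end
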